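import Literature.Probability.Percolation.InterfaceTraversalBoundData2
import HarnessLib

/-!
# Multiple shell crossings by the bond interface of ARBITRARY discrete Dobrushin data, III:
disjoint crossings from many traversals

Topic: Probability / Percolation. Third file of the verbatim generalisation of
`InterfaceTraversalBound.lean` (Aizenman–Burchard, Duke Math. J. 99 (1999), Appendix A, for the
medial exploration path of critical bond percolation on `δℤ²`) from the canonical data
`dobrushinData D δ` to arbitrary data `⟨D.carrier, δ, arcA, arcB⟩` (`arcA arcB : Set ℂ` free;
see `InterfaceTraversalBoundData.lean` for the rationale). Contents: the deterministic core
`arms_of_hasTraversals_data` — if the exploration polygon of admissible data traverses a shell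
many times, then `ω` contains many vertex-disjoint open crossings of a slightly smaller annulus,
or `dualConfig ω` many disjoint dual-open crossings (side components of the middle darts are
pairwise distinct in pairs, few are tainted by boundary points, the untainted ones carry the
chains).

References: M. Aizenman, A. Burchard, Duke Math. J. 99 (1999) 419–453, Appendix A;
S. Smirnov, C. R. Acad. Sci. Paris 333 (2001), §2.
-/

noncomputable section

open MeasureTheory Metric Set Filter Topology
open scoped Pointwise unitInterval

namespace Literature.Probability.Percolation

open LatticeModels LatticeModels.IsMedialExploration

variable {Dm : RandomPlanarGeometry.DobrushinDomain} {δ : ℝ} {arcA arcB : Set ℂ}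
  {ω : BondConfig (Site 2)} {a : MedialVertex} {l : List MedialVertex}

/-! ### The deterministic core: disjoint crossings from many traversals -/

/-- **Disjoint crossings from many traversals** (the deterministic core of Aizenman–Burchard
1999, Appendix A, for the bond exploration interface; arbitrary arcs, same proof as
`arms_of_hasTraversals`). Let the exploration polygon of `ω` in the data `⟨D, δ, arcA, arcB⟩`
(admissible, `δ ≤ ρ`) traverse `D(x; ρ, R)` at least
`k ≥ (2j₀ + ⌊1/θ⌋₊ + 2 choose 2) + 3` times, where `R ≥ 16Cρ`, `C ≥ 16`, and `θ > 0` is a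
modulus of uniform continuity of the boundary curve at scale `ρ`. Then `ω` contains `j₀`
pairwise vertex-disjoint open crossings of the annulus `A(x; Cρ + 3δ, R/4 - 3δ)`, or
`dualConfig ω` contains `j₀` pairwise disjoint dual-open crossings of it: the side components
of the `k` middle darts have pairwise distinct unordered pairs (`sidePair_ne`), hence are at
least `2j₀ + ⌊1/θ⌋₊ + 2` in number; at most `⌊1/θ⌋₊ + 1` of them are tainted by boundary points
(`card_le_of_separated_frontier_points`, `exists_frontier_of_leftTaint_data`/`_rightTaint_data`); the
chains of `j₀` untainted ones of the same side are the crossings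
(`left_step_of_untainted`/`right_step_of_untainted`,
`mem_disjointOccurrencePow_annulusOpenCrossing_of_chains`). [cite: AizenmanBurchardDuke1999, Appendix A] -/
theorem arms_of_hasTraversals_data (hδ : 0 < δ) (hadm : (⟨Dm.carrier, δ, arcA, arcB⟩ : DiscreteDobrushin).IsZdAdmissible)
    (hexp : IsMedialExploration (⟨Dm.carrier, δ, arcA, arcB⟩ : DiscreteDobrushin) ω (a :: l)) {x : ℂ} {ρ R C θ : ℝ}
    (hδρ : δ ≤ ρ) (hC : 16 ≤ C) (hR : 16 * C * ρ ≤ R) (hθ : 0 < θ)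
    (hmod : ∀ s t : ℝ, |s - t| < θ → dist (Dm.boundary s) (Dm.boundary t) < ρ) {j₀ k : ℕ}
    (hk : (2 * j₀ + ⌊1 / θ⌋₊ + 2).choose 2 + 3 ≤ k)
    (htr : (⟨polyline ((a :: l).map (medialPoint δ))⟩ : RandomPlanarGeometry.Curve ℂ).HasTraversals k x ρ R) :
    ω ∈ disjointOccurrencePow (annulusOpenCrossing x δ (C * ρ + 3 * δ) (R / 4 - 3 * δ)) j₀ ∨
      dualConfig ω ∈
        disjointOccurrencePow (annulusOpenCrossing x δ (C * ρ + 3 * δ) (R / 4 - 3 * δ)) j₀ := by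
  classical
  have hδ' : 0 < (⟨Dm.carrier, δ, arcA, arcB⟩ : DiscreteDobrushin).δ := hδ
  have hρ : 0 < ρ := hδ.trans_le hδρ
  have hCρ : 16 * ρ ≤ C * ρ := mul_le_mul_of_nonneg_right hC hρ.le
  have hk3 : 3 ≤ k := le_of_add_le_right hk
  set n := ((a :: l).zip l).length with hn
  set 𝔸 : Set ℂ := ball x (R / 2) \ closedBall x (4 * ρ) with h𝔸
  set X : Set ℂ := 𝔸 \ hexp.pertTrace with hX
  obtain ⟨sT, tT, htrav, hsep⟩ := htr
  have hdata := fun q : Fin k => traversal_data_data hδ hexp hδρ hC hR (htrav q)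
  choose m i' j' hspec using hdata
  have hm1 := fun q => (hspec q).1
  have hm2 := fun q => (hspec q).2.1
  have hi'm := fun q => (hspec q).2.2.1
  have hmj' := fun q => (hspec q).2.2.2.1
  have hsi' := fun q => (hspec q).2.2.2.2.1
  have hj't := fun q => (hspec q).2.2.2.2.2.1
  have hends := fun q => (hspec q).2.2.2.2.2.2.1
  have hside := fun q => (hspec q).2.2.2.2.2.2.2.1
  have hball := fun q => (hspec q).2.2.2.2.2.2.2.2.1
  have hrad := fun q => (hspec q).2.2.2.2.2.2.2.2.2.1
  have hcends := fun q => (hspec q).2.2.2.2.2.2.2.2.2.2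
  clear hspec
  have htn : ∀ q, tIdx l (tT q) < n := fun q => tIdx_lt_data hexp (tT q)
  have hmn : ∀ q, m q < n := fun q => (hm2 q).trans (htn q)
  have hj'n : ∀ q, j' q < n := fun q => (hj't q).trans_lt (htn q)
  -- side components and their pairs
  set cL : Fin k → Set ℂ := fun q => connectedComponentIn X (hexp.leftPt (m q)) with hcL
  set cR : Fin k → Set ℂ := fun q => connectedComponentIn X (hexp.rightPt (m q)) with hcR
  -- ordering of traversals in terms of indices
  have horder : ∀ q q' : Fin k, q ≠ q' → m q < tIdx l (sT q') ∨ tIdx l (tT q') < m q := by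
    intro q q' hqq
    rcases lt_or_gt_of_ne hqq with h | h
    · left
      exact (hm2 q).trans_le (tIdx_mono l (hsep h).le)
    · right
      exact (tIdx_mono l (hsep h).le).trans_lt (hm1 q)
  have hpair : ∀ q q' : Fin k, q ≠ q' → s(cL q, cR q) ≠ s(cL q', cR q') := by
    intro q q' hqq
    obtain ⟨c, hcq, hcq'⟩ := Fin.exists_ne_and_ne_of_two_lt q q' hk3
    have hle' := ((hsi' q').trans (hi'm q')).trans ((hmj' q').trans (hj't q'))
    have hlec := ((hsi' c).trans (hi'm c)).trans ((hmj' c).trans (hj't c))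
    have key := hexp.sidePair_ne hδ' (x := x) (r₁ := 4 * ρ) (r₂ := R / 2) (by positivity) (by linarith)
      (ma := m q) (mb := m q') (ib := tIdx l (sT q')) (kb := tIdx l (tT q') - tIdx l (sT q'))
      (ic := tIdx l (sT c)) (kc := tIdx l (tT c) - tIdx l (sT c)) (hmn q)
      (by rw [Nat.add_sub_cancel' hle']; exact htn q') (by rw [Nat.add_sub_cancel' hlec]; exact htn c)
      ⟨(hsi' q').trans (hi'm q'), by rw [Nat.add_sub_cancel' hle']; exact (hmj' q').trans (hj't q')⟩
      (by rw [Nat.add_sub_cancel' hle']; exact horder q q' hqq)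
      (by rw [Nat.add_sub_cancel' hlec]; exact horder q c (Ne.symm hcq))
      (by rw [Nat.add_sub_cancel' hlec]; exact horder q' c (Ne.symm hcq'))
      (hside q) (hside q')
      (by rw [Nat.add_sub_cancel' hle']; exact hends q') (by rw [Nat.add_sub_cancel' hlec]; exact hends c)
    exact key
  -- the finset of side components
  set comp : Fin k × Bool → Set ℂ := fun qb => if qb.2 then cL qb.1 else cR qb.1 with hcomp
  set Cset : Finset (Set ℂ) := Finset.univ.image comp with hCset
  have hcLmem : ∀ q, cL q ∈ Cset := fun q => Finset.mem_image.2 ⟨(q, true), Finset.mem_univ _, by simp [hcomp]⟩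
  have hcRmem : ∀ q, cR q ∈ Cset := fun q => Finset.mem_image.2 ⟨(q, false), Finset.mem_univ _, by simp [hcomp]⟩
  have hmemCset : ∀ c ∈ Cset, ∃ q, c = cL q ∨ c = cR q := by
    intro c hc
    obtain ⟨⟨q, b⟩, -, rfl⟩ := Finset.mem_image.1 hc
    cases b
    · exact ⟨q, Or.inr (by simp [hcomp])⟩
    · exact ⟨q, Or.inl (by simp [hcomp])⟩
  -- `k ≤ (V + 1).choose 2`, hence `V ≥ 2 j₀ + ⌊1/θ⌋₊ + 2`
  set V := Cset.card with hV
  have hkV : k ≤ (V + 1).choose 2 := by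
    have h1 : (Finset.univ.image fun q : Fin k => s(cL q, cR q)).card = k := by
      rw [Finset.card_image_of_injective _ fun q q' h => by_contra fun hne => hpair q q' hne h]
      simp
    have h2 : (Finset.univ.image fun q : Fin k => s(cL q, cR q)) ⊆ Cset.sym2 := by
      intro p hp
      obtain ⟨q, -, rfl⟩ := Finset.mem_image.1 hp
      rw [Finset.mk_mem_sym2_iff]
      exact ⟨hcLmem q, hcRmem q⟩
    have := Finset.card_le_card h2
    rw [h1, Finset.card_sym2] at this
    exact this
  have hVge : 2 * j₀ + ⌊1 / θ⌋₊ + 2 ≤ V := by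
    by_contra h
    push Not at h
    have h1 : (V + 1).choose 2 ≤ (2 * j₀ + ⌊1 / θ⌋₊ + 2).choose 2 := Nat.choose_le_choose 2 (by omega)
    omega
  -- tainted components
  set Tset : Finset (Set ℂ) := Cset.filter (fun c => ∃ z ∈ c, z ∈ frontier Dm.carrier ∧
    4 * ρ + ρ ≤ dist z x ∧ dist z x ≤ R / 2 - ρ) with hTset
  have hcomp_eq : ∀ c ∈ Cset, ∀ z ∈ c, connectedComponentIn X z = c := by
    intro c hc z hz
    obtain ⟨q, rfl | rfl⟩ := hmemCset c hc
    · exact (connectedComponentIn_eq hz).symm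
    · exact (connectedComponentIn_eq hz).symm
  have hTcard : Tset.card ≤ ⌊1 / θ⌋₊ + 1 := by
    have hex : ∀ c ∈ Tset, ∃ z, z ∈ c ∧ z ∈ frontier Dm.carrier ∧ 4 * ρ + ρ ≤ dist z x ∧ dist z x ≤ R / 2 - ρ := by
      intro c hc
      obtain ⟨-, z, hz, h⟩ := Finset.mem_filter.1 hc
      exact ⟨z, hz, h⟩
    choose! zc hzc using hex
    have hinj : Set.InjOn zc Tset := by
      intro c hc c' hc' h
      have h1 := hcomp_eq c (Finset.mem_filter.1 hc).1 _ (hzc c hc).1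
      have h2 := hcomp_eq c' (Finset.mem_filter.1 hc').1 _ (hzc c' hc').1
      rw [← h1, ← h2, h]
    rw [← Finset.card_image_of_injOn hinj]
    refine card_le_of_separated_frontier_points Dm.toJordanDomain (x := x) (r₁ := 4 * ρ) (r₂ := R / 2)
      hθ hmod (K := hexp.pertTrace)
      (pertTrace_disjoint_frontier_data hδ hexp) _ (fun z hz => ?_) (fun z hz z' hz' hzz => ?_)
    · obtain ⟨c, hc, rfl⟩ := Finset.mem_image.1 hz
      exact (hzc c hc).2
    · obtain ⟨c, hc, rfl⟩ := Finset.mem_image.1 hz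
      obtain ⟨c', hc', rfl⟩ := Finset.mem_image.1 hz'
      rw [hcomp_eq c (Finset.mem_filter.1 hc).1 _ (hzc c hc).1,
        hcomp_eq c' (Finset.mem_filter.1 hc').1 _ (hzc c' hc').1]
      exact fun h => hzz (by rw [h])
  -- untainted components, by side
  set U := Cset \ Tset with hU
  have hUcard : 2 * j₀ + 1 ≤ U.card := by
    have hct : U.card + Tset.card = Cset.card :=
      Finset.card_sdiff_add_card_eq_card (Finset.filter_subset _ Cset : Tset ⊆ Cset)
    omega
  set UL := U.filter (fun c => ∃ q, c = cL q) with hUL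
  set UR := U.filter (fun c => ∃ q, c = cR q) with hUR
  have hULR : U ⊆ UL ∪ UR := by
    intro c hc
    obtain ⟨q, h | h⟩ := hmemCset c (Finset.mem_sdiff.1 hc).1
    · exact Finset.mem_union_left _ (Finset.mem_filter.2 ⟨hc, q, h⟩)
    · exact Finset.mem_union_right _ (Finset.mem_filter.2 ⟨hc, q, h⟩)
  have hsides : j₀ ≤ UL.card ∨ j₀ ≤ UR.card := by
    by_contra h
    push Not at h
    have hle : U.card ≤ UL.card + UR.card := (Finset.card_le_card hULR).trans (Finset.card_union_le _ _)
    omega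
  -- untainted means: no boundary point of the middle annulus in the component
  have huntaint : ∀ c ∈ U, ∀ z ∈ c, z ∈ frontier Dm.carrier → 4 * ρ + ρ ≤ dist z x →
      dist z x ≤ R / 2 - ρ → False := by
    intro c hc z hz h1 h2 h3
    obtain ⟨hc1, hc2⟩ := Finset.mem_sdiff.1 hc
    exact hc2 (Finset.mem_filter.2 ⟨hc1, z, hz, h1, h2, h3⟩)
  -- radii of boundary points near the stretches
  have hradius : ∀ q i, i' q ≤ i → i ≤ j' q → ∀ z, dist z (meshPoint δ (hexp.cv i)) ≤ 4 * δ →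
      4 * ρ + ρ ≤ dist z x ∧ dist z x ≤ R / 2 - ρ := by
    intro q i h1 h2 z hz
    obtain ⟨h3, h4⟩ := hrad q i h1 h2
    constructor
    · linarith [dist_triangle (meshPoint δ (hexp.cv i)) z x, dist_comm z (meshPoint δ (hexp.cv i))]
    · linarith [dist_triangle z (meshPoint δ (hexp.cv i)) x]
  have hr'R' : C * ρ + 3 * δ ≤ R / 4 - 3 * δ + 2 * δ := by linarith
  rcases hsides with hL | hRs
  · -- **left chains**: `ω` has `j₀` disjoint open crossings
    left
    obtain ⟨f, hfinj, hfmem⟩ := exists_injective_of_le_card hL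
    have hfU : ∀ i, f i ∈ U := fun i => (Finset.mem_filter.1 (hfmem i)).1
    have hfq : ∀ i, ∃ q, f i = cL q := fun i => (Finset.mem_filter.1 (hfmem i)).2
    choose qf hqf using hfq
    -- no vertex of the stretch `qf i` is on the arc `A`
    have hnoA : ∀ i j, i' (qf i) ≤ j → j ≤ j' (qf i) → hexp.cv j ∉ (⟨Dm.carrier, δ, arcA, arcB⟩ : DiscreteDobrushin).zdArcA := by
      intro i j h1 h2 hjA
      obtain ⟨z, hzfr, hzc, hzd⟩ := exists_frontier_of_leftTaint_data hδ hexp (A := 𝔸) (hj'n (qf i))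
        (hball (qf i)) (hi'm (qf i)) (hmj' (qf i)) h1 h2 hjA
      obtain ⟨hr1, hr2⟩ := hradius (qf i) j h1 h2 z (by linarith)
      refine huntaint _ (hfU i) z ?_ hzfr hr1 hr2
      rw [hqf i]; exact hzc
    -- vertices of the stretch lie in the component `f i`
    have hvmem : ∀ i j, i' (qf i) ≤ j → j ≤ j' (qf i) → meshPoint δ (hexp.cv j) ∈ f i := by
      intro i j h1 h2
      rw [hqf i]
      have hball' : ∀ j, i' (qf i) ≤ j → j ≤ j' (qf i) → closedBall (meshPoint δ (hexp.cv j)) δ ⊆ 𝔸 :=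
        fun j h1 h2 => (closedBall_subset_closedBall (by linarith)).trans (hball (qf i) j h1 h2)
      exact hexp.cv_mem_connectedComponentIn hδ' (hj'n (qf i)) hball' h1 h2 (hi'm (qf i)) (hmj' (qf i))
    have hmem := mem_disjointOccurrencePow_annulusOpenCrossing_of_chains (ω := ω ∩ (zdGraph 2).edgeSet)
      hδ.le (x := x) hr'R' (fun v w h => by
        rw [dist_meshPoint_of_adj ((SimpleGraph.mem_edgeSet _).1 h.2), abs_of_pos hδ])
      (j := j₀) (N := fun i => j' (qf i) - i' (qf i))
      (fun i p => hexp.cv (i' (qf i) + p)) (fun i p hp => ?_) (fun i => ?_) (fun i i₂ hii p p' heq => ?_)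
    · exact (isUpperSet_annulusOpenCrossing x δ _ _).disjointOccurrencePow j₀ inter_subset_left hmem
    · -- chain step
      have h1 : i' (qf i) + p + 1 ≤ j' (qf i) := by
        have := p.2; have := hi'm (qf i); have := hmj' (qf i); omega
      rcases left_step_of_untainted hexp (i := i' (qf i) + p + 1) (by omega) (by have := hj'n (qf i); omega)
        (hnoA i _ (by omega) h1) with h | ⟨h, hadj⟩
      · left; simpa [Nat.add_sub_cancel, add_assoc] using h
      · right
        simp only [Nat.add_sub_cancel] at h hadj
        rw [← add_assoc]
        exact ⟨h, (SimpleGraph.mem_edgeSet _).2 hadj⟩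
    · -- ends
      simp only [Fin.val_zero, add_zero, Fin.val_last, Nat.add_sub_cancel' (hi'm (qf i) |>.trans (hmj' (qf i)))]
      rcases hcends (qf i) with ⟨h1, h2⟩ | ⟨h1, h2⟩
      · left; constructor <;> linarith
      · right; constructor <;> linarith
    · -- disjointness: a common vertex would lie in two distinct components
      have h1 := hvmem i (i' (qf i) + p) (by omega)
        (by have := p.2; have := hi'm (qf i); have := hmj' (qf i); omega)
      have h2 := hvmem i₂ (i' (qf i₂) + p') (by omega)
        (by have := p'.2; have := hi'm (qf i₂); have := hmj' (qf i₂); omega)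
      rw [heq] at h1
      have hc1 := hcomp_eq (f i) (Finset.mem_sdiff.1 (hfU i)).1 _ h1
      have hc2 := hcomp_eq (f i₂) (Finset.mem_sdiff.1 (hfU i₂)).1 _ h2
      exact hii (hfinj (hc1.symm.trans hc2))
  · -- **right chains**: `dualConfig ω` has `j₀` disjoint open crossings of the dual lattice
    right
    obtain ⟨f, hfinj, hfmem⟩ := exists_injective_of_le_card hRs
    have hfU : ∀ i, f i ∈ U := fun i => (Finset.mem_filter.1 (hfmem i)).1
    have hfq : ∀ i, ∃ q, f i = cR q := fun i => (Finset.mem_filter.1 (hfmem i)).2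
    choose qf hqf using hfq
    -- no corner of a face of the stretch `qf i` is on the arc `B`
    have hnoB : ∀ i j, i' (qf i) ≤ j → j ≤ j' (qf i) → ∀ u', IsCorner u' (hexp.cf j) →
        u' ∉ (⟨Dm.carrier, δ, arcA, arcB⟩ : DiscreteDobrushin).zdArcB := by
      intro i j h1 h2 u' hu' hB
      obtain ⟨z, hzfr, hzc, hzd⟩ := exists_frontier_of_rightTaint_data hδ hadm hexp (A := 𝔸) (hj'n (qf i))
        (hball (qf i)) (hi'm (qf i)) (hmj' (qf i)) h1 h2 hu' hB
      obtain ⟨hr1, hr2⟩ := hradius (qf i) j h1 h2 z hzd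
      refine huntaint _ (hfU i) z ?_ hzfr hr1 hr2
      rw [hqf i]; exact hzc
    have hfcmem : ∀ i j, i' (qf i) ≤ j → j ≤ j' (qf i) → (δ • faceCenter (hexp.cf j) : ℂ) ∈ f i := by
      intro i j h1 h2
      rw [hqf i]
      have hball' : ∀ j, i' (qf i) ≤ j → j ≤ j' (qf i) → closedBall (meshPoint δ (hexp.cv j)) δ ⊆ 𝔸 :=
        fun j h1 h2 => (closedBall_subset_closedBall (by linarith)).trans (hball (qf i) j h1 h2)
      exact hexp.cf_mem_connectedComponentIn hδ' (hj'n (qf i)) hball' h1 h2 (hi'm (qf i)) (hmj' (qf i))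
    -- the corner `cf j` of the face `cf j` is within `2δ` of `cv j`
    have hcfcv : ∀ j, j < n → dist (meshPoint δ (hexp.cf j)) (meshPoint δ (hexp.cv j)) ≤ 2 * δ := by
      intro j hj
      have := closedSq_subset_closedBall (hexp.isCorner hj) (toComplex_mem_closedSq (isCorner_self (hexp.cf j)))
      rw [mem_closedBall] at this
      rw [meshPoint_eq_smul, meshPoint_eq_smul, dist_smul₀, Real.norm_eq_abs, abs_of_pos hδ]
      nlinarith
    refine mem_disjointOccurrencePow_annulusOpenCrossing_of_chains (ω := dualConfig ω)
      hδ.le (x := x) hr'R' (fun v w h => by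
        rw [dist_meshPoint_of_adj ((SimpleGraph.mem_edgeSet _).1 (mem_dualConfig_iff.1 h).1), abs_of_pos hδ])
      (j := j₀) (N := fun i => j' (qf i) - i' (qf i))
      (fun i p => hexp.cf (i' (qf i) + p)) (fun i p hp => ?_) (fun i => ?_) (fun i i₂ hii p p' heq => ?_)
    · have h1 : i' (qf i) + p + 1 ≤ j' (qf i) := by
        have := p.2; have := hi'm (qf i); have := hmj' (qf i); omega
      rcases right_step_of_untainted hexp (i := i' (qf i) + p + 1) (by omega) (by have := hj'n (qf i); omega)
        (by simpa only [Nat.add_sub_cancel] using hnoB i (i' (qf i) + p) (by omega) (by omega)) with h | h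
      · left; simpa [Nat.add_sub_cancel, add_assoc] using h
      · right
        simp only [Nat.add_sub_cancel] at h
        rw [← add_assoc]
        exact h
    · simp only [Fin.val_zero, add_zero, Fin.val_last, Nat.add_sub_cancel' (hi'm (qf i) |>.trans (hmj' (qf i)))]
      have h3 := hcfcv (i' (qf i)) (by have := hj'n (qf i); have := hi'm (qf i); have := hmj' (qf i); omega)
      have h4 := hcfcv (j' (qf i)) (hj'n (qf i))
      rcases hcends (qf i) with ⟨h1, h2⟩ | ⟨h1, h2⟩
      · left; constructor
        · linarith [dist_triangle (meshPoint δ (hexp.cf (i' (qf i)))) (meshPoint δ (hexp.cv (i' (qf i)))) x]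
        · linarith [dist_triangle (meshPoint δ (hexp.cv (j' (qf i)))) (meshPoint δ (hexp.cf (j' (qf i)))) x,
            dist_comm (meshPoint δ (hexp.cf (j' (qf i)))) (meshPoint δ (hexp.cv (j' (qf i))))]
      · right; constructor
        · linarith [dist_triangle (meshPoint δ (hexp.cv (i' (qf i)))) (meshPoint δ (hexp.cf (i' (qf i)))) x,
            dist_comm (meshPoint δ (hexp.cf (i' (qf i)))) (meshPoint δ (hexp.cv (i' (qf i))))]
        · linarith [dist_triangle (meshPoint δ (hexp.cf (j' (qf i)))) (meshPoint δ (hexp.cv (j' (qf i)))) x]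
    · have h1 := hfcmem i (i' (qf i) + p) (by omega)
        (by have := p.2; have := hi'm (qf i); have := hmj' (qf i); omega)
      have h2 := hfcmem i₂ (i' (qf i₂) + p') (by omega)
        (by have := p'.2; have := hi'm (qf i₂); have := hmj' (qf i₂); omega)
      rw [heq] at h1
      have hc1 := hcomp_eq (f i) (Finset.mem_sdiff.1 (hfU i)).1 _ h1
      have hc2 := hcomp_eq (f i₂) (Finset.mem_sdiff.1 (hfU i₂)).1 _ h2
      exact hii (hfinj (hc1.symm.trans hc2))

end Literature.Probability.Percolation

end
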